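import Literature.Topology.FourManifolds.PlumbingCorner
import Mathlib.Analysis.Convex.Contractible
import Mathlib.Topology.Homotopy.Contractible
import Mathlib.AlgebraicTopology.FundamentalGroupoid.SimplyConnected
import HarnessLib

/-!
# The corner regions `{0 < G < ε₀}`, `{G < ε₀}` of a plumbing square are contractible

Topic `Literature/Topology/FourManifolds` (fact seat of
`Literature.Topology.FourManifolds.HomotopySphere.exists_intersectionForm_equivalent_e8Form`,
Kosinski's `E₈` plumbing `M(4m)`, *Differential Manifolds* (1993), VI.12). Towards VI.(12.1)
(`π₁(∂M(4m)) = 1`, `k > 2`) in the form reduced by `PlumbingBoundaryReduction.lean`: in a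
plumbing chart with squared radii `(a, b) ∈ (0, r²)²` the size function is the corner function
`G = cornerFn r² (1/4)` (`PlumbingCorner.lean`), and the traces of `{0 < ρ < ε₀}` and of
`{ρ < ε₀}` on the square are the planar regions

  `V = {(a, b) ∈ (0, r²)² | 0 < G(a, b) < ε₀}`, `W = {(a, b) ∈ (0, r²)² | G(a, b) < ε₀}`.

We prove both are CONTRACTIBLE (hence simply connected and path connected), `0 < ε₀ ≤ r²/2`. In
the coordinates `w = a - b`, `τ = min(a, b)` the function `G` increases in `τ` with slope `≥ 1`
(`cornerFn_add_le_cornerFn_diag`), so the fibres of `V`, `W` over `w` are intervals; a continuous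
section `w ↦ sec(w)` exists — the root of `G = ε₀/2` over the central band `|w| ≤ 2r²/5` (where the
fibre is long), and the explicit point `τ = min(ε₀, r² - |w|)/2` over the outer bands (where
`G = min(a, b) = τ` off the wedge, `cornerFn_eq_min`) — and sliding along `τ` deforms the region
onto the section, a copy of the interval `(-r², r²)`.

* `Plumbing.cornerFn_add_le_of_sameLine` — slope `≥ 1` along the lines `a - b = const`;
* `Plumbing.exists_root_cornerFn_line`, `Plumbing.continuousOn_cornerSec` — the section;
* **`Plumbing.contractibleSpace_cornerRegionPos`**, **`Plumbing.contractibleSpace_cornerRegion`**,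
  and the corollaries `isSimplyConnected_…`, `isPathConnected_…`.

Everything is proved; no definitions, no named facts (D-0026).

## References

* A. Kosinski, *Differential Manifolds*, Academic Press 1993, VI.6, VI.12 p. 120, (12.1).
  [Kosinski1993]
* A. Hatcher, *Algebraic Topology*, CUP 2002, Ch. 0 (deformation retractions), Prop. 1.14ff.
  [HatcherAT2002]
-/

open scoped Topology unitInterval
open Set Function Filter

noncomputable section

namespace Literature.Topology.FourManifolds

namespace Plumbing

variable {r2 ε₀ : ℝ}

/-! ### Slope `≥ 1` along the lines `a - b = w` -/

/-- **Slope `≥ 1` along the diagonal direction**: for `p, q` on a line `a - b = w` with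
`p.1 ≤ q.1` (and `q` in the half plane `a + b < 2r²`), `G(p) + (q.1 - p.1) ≤ G(q)`.
[cite: Kosinski1993, VI.6] -/
theorem cornerFn_add_le_of_sameLine {s : ℝ} (hs : 0 < s) {p q : ℝ × ℝ} (hw : p.1 - p.2 = q.1 - q.2)
    (hle : p.1 ≤ q.1) (hq : q.1 + q.2 < 2 * r2) :
    cornerFn r2 s p + (q.1 - p.1) ≤ cornerFn r2 s q := by
  have hq' : q = (p.1 + (q.1 - p.1), p.2 + (q.1 - p.1)) := by
    ext <;> simp only <;> linarith
  have h := cornerFn_add_le_cornerFn_diag (r2 := r2) (a := p.1) (b := p.2) hs (τ := q.1 - p.1)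
    (by linarith) (by linarith)
  rw [congrArg (cornerFn r2 s) hq']
  simpa only [Prod.mk.eta] using h

/-- Strict monotonicity along the lines `a - b = w`. [cite: Kosinski1993, VI.6] -/
theorem cornerFn_lt_of_sameLine {s : ℝ} (hs : 0 < s) {p q : ℝ × ℝ} (hw : p.1 - p.2 = q.1 - q.2)
    (hlt : p.1 < q.1) (hq : q.1 + q.2 < 2 * r2) : cornerFn r2 s p < cornerFn r2 s q := by
  have := cornerFn_add_le_of_sameLine hs hw hlt.le hq
  linarith

/-! ### The regions and their fibres -/

/-- **Order-connectedness of the fibres of `V = {0 < G < ε₀} ∩ (0, r²)²`** along the lines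
`a - b = w`: a point between two points of `V` on such a line lies in `V`. [folklore] -/
theorem mem_cornerRegionPos_of_between {s : ℝ} (hs : 0 < s) {p q m : ℝ × ℝ}
    (hp : 0 < p.1 ∧ 0 < p.2 ∧ p.1 < r2 ∧ p.2 < r2 ∧ 0 < cornerFn r2 s p ∧ cornerFn r2 s p < ε₀)
    (hq : 0 < q.1 ∧ 0 < q.2 ∧ q.1 < r2 ∧ q.2 < r2 ∧ 0 < cornerFn r2 s q ∧ cornerFn r2 s q < ε₀)
    (hwp : p.1 - p.2 = m.1 - m.2) (hwq : q.1 - q.2 = m.1 - m.2)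
    (h1 : p.1 ≤ m.1) (h2 : m.1 ≤ q.1) :
    0 < m.1 ∧ 0 < m.2 ∧ m.1 < r2 ∧ m.2 < r2 ∧ 0 < cornerFn r2 s m ∧ cornerFn r2 s m < ε₀ := by
  obtain ⟨hp1, hp2, hp3, hp4, hp5, hp6⟩ := hp
  obtain ⟨hq1, hq2, hq3, hq4, hq5, hq6⟩ := hq
  have hm2 : p.2 ≤ m.2 := by linarith
  have hm2' : m.2 ≤ q.2 := by linarith
  refine ⟨by linarith, by linarith, by linarith, by linarith, ?_, ?_⟩
  · have := cornerFn_add_le_of_sameLine (r2 := r2) hs hwp h1 (by linarith)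
    linarith
  · have := cornerFn_add_le_of_sameLine (r2 := r2) hs hwq.symm h2 (by linarith)
    linarith

/-- Order-connectedness of the fibres of `W = {G < ε₀} ∩ (0, r²)²`. [folklore] -/
theorem mem_cornerRegion_of_between {s : ℝ} (hs : 0 < s) {p q m : ℝ × ℝ}
    (hp : 0 < p.1 ∧ 0 < p.2 ∧ p.1 < r2 ∧ p.2 < r2 ∧ cornerFn r2 s p < ε₀)
    (hq : 0 < q.1 ∧ 0 < q.2 ∧ q.1 < r2 ∧ q.2 < r2 ∧ cornerFn r2 s q < ε₀)
    (hwp : p.1 - p.2 = m.1 - m.2) (hwq : q.1 - q.2 = m.1 - m.2)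
    (h1 : p.1 ≤ m.1) (h2 : m.1 ≤ q.1) :
    0 < m.1 ∧ 0 < m.2 ∧ m.1 < r2 ∧ m.2 < r2 ∧ cornerFn r2 s m < ε₀ := by
  obtain ⟨hp1, hp2, hp3, hp4, hp6⟩ := hp
  obtain ⟨hq1, hq2, hq3, hq4, hq6⟩ := hq
  have hm2 : p.2 ≤ m.2 := by linarith
  have hm2' : m.2 ≤ q.2 := by linarith
  refine ⟨by linarith, by linarith, by linarith, by linarith, ?_⟩
  have := cornerFn_add_le_of_sameLine (r2 := r2) hs hwq.symm h2 (by linarith)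
  linarith

/-! ### The line map `L(w, τ) = (w⁺ + τ, w⁻ + τ)` -/

/-- `max w 0 - max (-w) 0 = w` — this is Mathlib's `max_zero_sub_max_neg_zero_eq_self`; kept as a
deprecated alias (librarian dedup-01521). [folklore] -/
@[deprecated max_zero_sub_max_neg_zero_eq_self (since := "2026-08-16")]
alias posPart_sub_negPart' := max_zero_sub_max_neg_zero_eq_self

/-- `max w 0 + max (-w) 0 = |w|` — this is Mathlib's `max_zero_add_max_neg_zero_eq_abs_self`;
kept as a deprecated alias (librarian dedup-01522). [folklore] -/
@[deprecated max_zero_add_max_neg_zero_eq_abs_self (since := "2026-08-16")]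
alias posPart_add_negPart' := max_zero_add_max_neg_zero_eq_abs_self

/-- Continuity of `L` in `(w, τ)`. [folklore] -/
theorem continuous_lineMap :
    Continuous fun wτ : ℝ × ℝ => (max wτ.1 0 + wτ.2, max (-wτ.1) 0 + wτ.2) := by
  fun_prop

/-- **`G` along the line through `(w⁺, w⁻)`**: slope `≥ 1`. [cite: Kosinski1993, VI.6] -/
theorem cornerFn_lineMap_add_le {s : ℝ} (hs : 0 < s) (w : ℝ) {τ τ' : ℝ} (hττ' : τ ≤ τ')
    (h : |w| + 2 * τ' < 2 * r2) :
    cornerFn r2 s (max w 0 + τ, max (-w) 0 + τ) + (τ' - τ) ≤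
      cornerFn r2 s (max w 0 + τ', max (-w) 0 + τ') := by
  have e := max_zero_add_max_neg_zero_eq_abs_self w
  have := cornerFn_add_le_of_sameLine (r2 := r2) hs
    (p := (max w 0 + τ, max (-w) 0 + τ)) (q := (max w 0 + τ', max (-w) 0 + τ'))
    (by simp only; ring) (by simp only; linarith) (by simp only; linarith)
  simpa using this

/-- At the base point `τ = 0` (on an axis), `G ≤ 0`. [folklore] -/
theorem cornerFn_lineMap_zero_nonpos {s : ℝ} (hs : 0 < s) {w : ℝ} (hw : |w| < 2 * r2) :
    cornerFn r2 s (max w 0 + 0, max (-w) 0 + 0) ≤ 0 := by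
  refine cornerFn_nonpos hs (by simp only; have := max_zero_add_max_neg_zero_eq_abs_self w; linarith) ?_
  simp only [add_zero]
  rcases le_total 0 w with h | h
  · rw [max_eq_right (show -w ≤ 0 by linarith)]; exact min_le_right _ _
  · rw [max_eq_right h]; exact min_le_left _ _

/-- **Off the wedge, `G = τ` on the line**: for `|w| ≥ 2r²/5` (`s = 1/4`) and `0 ≤ τ` with
`|w| + τ < r²` (inside the square), `G(w⁺ + τ, w⁻ + τ) = τ`. [cite: Kosinski1993, VI.6] -/
theorem cornerFn_lineMap_eq_of_outer {w τ : ℝ} (hw : 2 * r2 / 5 ≤ |w|)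
    (hτ : 0 ≤ τ) (hin : |w| + τ < r2) :
    cornerFn r2 (1 / 4) (max w 0 + τ, max (-w) 0 + τ) = τ := by
  have e1 := max_zero_add_max_neg_zero_eq_abs_self w
  have e2 := max_zero_sub_max_neg_zero_eq_self w
  have hsum : (max w 0 + τ) + (max (-w) 0 + τ) = |w| + 2 * τ := by linarith
  rw [cornerFn_eq_min (by norm_num : (0 : ℝ) < 1 / 4) (by simp only; linarith)]
  · simp only
    rw [min_add_add_right]
    rcases le_total 0 w with h | h
    · rw [max_eq_left h, max_eq_right (by linarith), min_eq_right h, zero_add]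
    · rw [max_eq_right h, max_eq_left (by linarith), min_eq_left (by linarith : (0 : ℝ) ≤ -w),
        zero_add]
  · -- the wedge condition `sec ≤ |a - b| = |w|`
    simp only [bandW]
    rw [show max w 0 + τ - (max (-w) 0 + τ) = w by linarith]
    nlinarith [abs_nonneg w]

/-! ### The section over the central band: the root of `G = ε₀ / 2` -/

/-- **Existence of the root** over the central band: for `|w| ≤ 2r²/5`, `0 < ε₀ ≤ r²/2`
(`s = 1/4`) there is a unique `τ ∈ [0, r²/2]` with `G(w⁺ + τ, w⁻ + τ) = ε₀/2` (intermediate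
value theorem: `G ≤ 0` at `τ = 0` and `G ≥ -(2r² - |w|)/8 + r²/2 ≥ ε₀/2` at `τ = r²/2`).
[cite: Kosinski1993, VI.6] -/
theorem exists_root_cornerFn_line (hε : 0 < ε₀) (hε' : ε₀ ≤ r2 / 2) {w : ℝ}
    (hw : |w| ≤ 2 * r2 / 5) :
    ∃ τ ∈ Icc (0 : ℝ) (r2 / 2), cornerFn r2 (1 / 4) (max w 0 + τ, max (-w) 0 + τ) = ε₀ / 2 := by
  have e1 := max_zero_add_max_neg_zero_eq_abs_self w
  have hcont : ContinuousOn (fun τ : ℝ => cornerFn r2 (1 / 4) (max w 0 + τ, max (-w) 0 + τ))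
      (Icc 0 (r2 / 2)) := by
    refine ContinuousOn.comp (continuousOn_cornerFn (r2 := r2) (by norm_num : (0 : ℝ) < 1 / 4))
      (by fun_prop : Continuous fun τ : ℝ => (max w 0 + τ, max (-w) 0 + τ)).continuousOn ?_
    intro τ hτ
    simp only [mem_setOf_eq]
    have := hτ.2; linarith
  have h0 : cornerFn r2 (1 / 4) (max w 0 + 0, max (-w) 0 + 0) ≤ ε₀ / 2 :=
    (cornerFn_lineMap_zero_nonpos (by norm_num : (0 : ℝ) < 1 / 4) (by linarith)).trans (by linarith)
  have h1 : ε₀ / 2 ≤ cornerFn r2 (1 / 4) (max w 0 + r2 / 2, max (-w) 0 + r2 / 2) := by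
    -- `G(L 0) ≥ min - sec/2 = -(2r² - |w|)/8`, then slope `≥ 1`
    have hlow : -(2 * r2 - |w|) / 8 ≤ cornerFn r2 (1 / 4) (max w 0 + 0, max (-w) 0 + 0) := by
      have h := min_sub_le_cornerFn (r2 := r2) (by norm_num : (0 : ℝ) < 1 / 4)
        (p := (max w 0 + 0, max (-w) 0 + 0)) (by simp only; linarith)
      simp only [add_zero, bandW] at h ⊢
      have hmin : min (max w 0) (max (-w) 0) = 0 := by
        rcases le_total 0 w with h' | h'
        · rw [max_eq_left h', max_eq_right (by linarith), min_eq_right h']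
        · rw [max_eq_right h', max_eq_left (by linarith), min_eq_left (by linarith : (0 : ℝ) ≤ -w)]
      rw [hmin] at h
      have e1' : max w 0 + max (-w) 0 = |w| := e1
      nlinarith [h, e1']
    have hslope := cornerFn_lineMap_add_le (r2 := r2) (by norm_num : (0 : ℝ) < 1 / 4) w
      (τ := 0) (τ' := r2 / 2) (by linarith) (by linarith)
    have habs := abs_nonneg w
    linarith
  obtain ⟨τ, hτ, hτeq⟩ := intermediate_value_Icc (by linarith : (0 : ℝ) ≤ r2 / 2) hcont ⟨h0, h1⟩
  exact ⟨τ, hτ, hτeq⟩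

/-- Continuity of `w ↦ G(L(w, τ))` at fixed `τ` (inside the half plane). [folklore] -/
theorem continuousAt_cornerFn_lineMap {s : ℝ} (hs : 0 < s) {w τ : ℝ} (h : |w| + 2 * τ < 2 * r2) :
    ContinuousAt (fun w' : ℝ => cornerFn r2 s (max w' 0 + τ, max (-w') 0 + τ)) w := by
  have e1 := max_zero_add_max_neg_zero_eq_abs_self w
  have hG : ContinuousAt (cornerFn r2 s) (max w 0 + τ, max (-w) 0 + τ) :=
    (continuousOn_cornerFn (r2 := r2) hs).continuousAt
      ((isOpen_lt (by fun_prop) continuous_const).mem_nhds (by simp only [mem_setOf_eq]; linarith))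
  have h2 : ContinuousAt (fun w' : ℝ => (max w' 0 + τ, max (-w') 0 + τ)) w :=
    (by fun_prop : Continuous fun w' : ℝ => (max w' 0 + τ, max (-w') 0 + τ)).continuousAt
  exact ContinuousAt.comp (f := fun w' : ℝ => (max w' 0 + τ, max (-w') 0 + τ)) hG h2

/-- **A continuous section of the corner regions**: there is `sec : ℝ → ℝ`, continuous on
`(-r², r²)`, with `sec(w) ≥ 0`, `|w| + sec(w) < r²` and `0 < G(w⁺ + sec(w), w⁻ + sec(w)) < ε₀`
(`0 < ε₀ ≤ r²/2`, `s = 1/4`): over the central band `|w| ≤ 2r²/5` the root of `G = ε₀/2`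
(continuous because `G` has slope `≥ 1` in `τ` and is continuous in `w`), over the outer bands
the explicit `τ = min(ε₀, r² - |w|)/2` where `G = τ`; the two agree at `|w| = 2r²/5`.
[cite: Kosinski1993, VI.6] -/
theorem exists_continuousOn_cornerSection (hε : 0 < ε₀) (hε' : ε₀ ≤ r2 / 2) :
    ∃ sec : ℝ → ℝ, ContinuousOn sec (Ioo (-r2) r2) ∧ ∀ w ∈ Ioo (-r2) r2, 0 ≤ sec w ∧ |w| + sec w < r2 ∧
      0 < cornerFn r2 (1 / 4) (max w 0 + sec w, max (-w) 0 + sec w) ∧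
      cornerFn r2 (1 / 4) (max w 0 + sec w, max (-w) 0 + sec w) < ε₀ := by
  classical
  have hr : 0 < r2 := by linarith
  have h4 : (0 : ℝ) < 1 / 4 := by norm_num
  -- the root over the central band
  have hroot : ∀ w : ℝ, |w| ≤ 2 * r2 / 5 →
      ∃ τ ∈ Icc (0 : ℝ) (r2 / 2), cornerFn r2 (1 / 4) (max w 0 + τ, max (-w) 0 + τ) = ε₀ / 2 :=
    fun w hw => exists_root_cornerFn_line hε hε' hw
  let ρ : ℝ → ℝ := fun w => if hw : |w| ≤ 2 * r2 / 5 then (hroot w hw).choose else 0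
  have hρ : ∀ w (hw : |w| ≤ 2 * r2 / 5), ρ w ∈ Icc (0 : ℝ) (r2 / 2) ∧
      cornerFn r2 (1 / 4) (max w 0 + ρ w, max (-w) 0 + ρ w) = ε₀ / 2 := by
    intro w hw
    simp only [ρ, dif_pos hw]
    exact (hroot w hw).choose_spec
  -- uniqueness of the root (slope `≥ 1`)
  have huniq : ∀ w (hw : |w| ≤ 2 * r2 / 5) (τ : ℝ), 0 ≤ τ → |w| + 2 * τ < 2 * r2 →
      cornerFn r2 (1 / 4) (max w 0 + τ, max (-w) 0 + τ) = ε₀ / 2 → τ = ρ w := by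
    intro w hw τ hτ0 hτ hGτ
    obtain ⟨⟨hρ0, hρ1⟩, hGρ⟩ := hρ w hw
    by_contra hne
    rcases lt_or_gt_of_ne hne with hlt | hlt
    · have := cornerFn_lineMap_add_le (r2 := r2) h4 w hlt.le (by linarith)
      linarith
    · have := cornerFn_lineMap_add_le (r2 := r2) h4 w hlt.le hτ
      linarith
  -- continuity of the root on the closed central band
  have hρc : ContinuousOn ρ {w | |w| ≤ 2 * r2 / 5} := by
    intro w₀ hw₀
    rw [Metric.continuousWithinAt_iff]
    intro ε hεpos
    set ε' : ℝ := min ε (r2 / 10) with hε'def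
    have hε'pos : 0 < ε' := lt_min hεpos (by linarith)
    have hε'le : ε' ≤ ε := min_le_left _ _
    have hε'le' : ε' ≤ r2 / 10 := min_le_right _ _
    obtain ⟨⟨hτ0, hτ1⟩, hG0⟩ := hρ w₀ hw₀
    set τ₀ := ρ w₀ with hτ₀def
    -- continuity of `w ↦ G(L(w, τ₀))` at `w₀`
    have hcw := continuousAt_cornerFn_lineMap (r2 := r2) h4 (w := w₀) (τ := τ₀)
      (by have := hw₀; simp only [mem_setOf_eq] at this; linarith)
    rw [Metric.continuousAt_iff] at hcw
    obtain ⟨δ, hδ, hδε⟩ := hcw ε' hε'pos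
    refine ⟨δ, hδ, fun w hw hdist => ?_⟩
    simp only [mem_setOf_eq] at hw
    have hclose := hδε hdist
    rw [Real.dist_eq, hG0] at hclose
    obtain ⟨⟨hsec0, hsec1⟩, hGw⟩ := hρ w hw
    rw [Real.dist_eq, abs_lt]
    have habs := abs_lt.1 hclose
    constructor
    · -- `ρ w > τ₀ - ε'`
      by_contra hcon
      push Not at hcon
      have hle : ρ w ≤ τ₀ - ε' := by linarith
      have := cornerFn_lineMap_add_le (r2 := r2) h4 w (show ρ w ≤ τ₀ by linarith) (by linarith)
      linarith
    · by_contra hcon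
      push Not at hcon
      have hle : τ₀ + ε' ≤ ρ w := by linarith
      have h1 := cornerFn_lineMap_add_le (r2 := r2) h4 w (show τ₀ ≤ ρ w by linarith) (by linarith)
      linarith
  -- the glued section
  let sec : ℝ → ℝ := fun w => if |w| ≤ 2 * r2 / 5 then ρ w else min ε₀ (r2 - |w|) / 2
  have hagree : ∀ w, |w| = 2 * r2 / 5 → ρ w = min ε₀ (r2 - |w|) / 2 := by
    intro w hw
    have hmin : min ε₀ (r2 - |w|) = ε₀ := min_eq_left (by rw [hw]; linarith)
    rw [hmin]
    symm
    refine huniq w hw.le (ε₀ / 2) (by linarith) (by rw [hw]; linarith) ?_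
    exact cornerFn_lineMap_eq_of_outer (r2 := r2) hw.ge (by linarith) (by rw [hw]; linarith)
  have hsecc : ContinuousOn sec (Ioo (-r2) r2) := by
    refine ContinuousOn.if ?_ ?_ ?_
    · rintro w ⟨-, hw⟩
      -- on the frontier `|w| = 2 r2 / 5`
      have hwle : |w| ≤ 2 * r2 / 5 := by
        have hcl : IsClosed {w : ℝ | |w| ≤ 2 * r2 / 5} := isClosed_le (by fun_prop) continuous_const
        exact hcl.frontier_subset hw
      have hwge : 2 * r2 / 5 ≤ |w| := by
        by_contra hlt
        push Not at hlt
        have hint : w ∈ interior {w : ℝ | |w| ≤ 2 * r2 / 5} := by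
          rw [mem_interior_iff_mem_nhds]
          have hO : IsOpen {w' : ℝ | |w'| < 2 * r2 / 5} := isOpen_lt continuous_abs continuous_const
          exact mem_of_superset (hO.mem_nhds hlt) fun w' (hw' : |w'| < 2 * r2 / 5) =>
            (le_of_lt hw' : |w'| ≤ 2 * r2 / 5)
        exact hw.2 hint
      exact hagree w (le_antisymm hwle hwge)
    · exact hρc.mono fun w hw => by
        have hcl : IsClosed {w : ℝ | |w| ≤ 2 * r2 / 5} := isClosed_le (by fun_prop) continuous_const
        rw [hcl.closure_eq] at hw
        exact hw.2
    · exact (by fun_prop : Continuous fun w : ℝ => min ε₀ (r2 - |w|) / 2).continuousOn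
  refine ⟨sec, hsecc, fun w hw => ?_⟩
  have hwabs : |w| < r2 := abs_lt.2 ⟨hw.1, hw.2⟩
  by_cases hwc : |w| ≤ 2 * r2 / 5
  · have hsecw : sec w = ρ w := if_pos hwc
    rw [hsecw]
    obtain ⟨⟨hsec0, hsec1⟩, hGw⟩ := hρ w hwc
    refine ⟨hsec0, by linarith, by rw [hGw]; linarith, by rw [hGw]; linarith⟩
  · have hsecw : sec w = min ε₀ (r2 - |w|) / 2 := if_neg hwc
    rw [hsecw]
    push Not at hwc
    have hm1 := min_le_left ε₀ (r2 - |w|)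
    have hm2 := min_le_right ε₀ (r2 - |w|)
    have hm0 : 0 < min ε₀ (r2 - |w|) := lt_min hε (by linarith)
    have hGeq := cornerFn_lineMap_eq_of_outer (r2 := r2) hwc.le (τ := min ε₀ (r2 - |w|) / 2)
      (by linarith) (by linarith)
    refine ⟨by linarith, by linarith, by rw [hGeq]; linarith, by rw [hGeq]; linarith⟩

/-! ### Contractibility -/

/-- **The region `V = {(a, b) ∈ (0, r²)² | 0 < G(a, b) < ε₀}` is contractible**
(`0 < ε₀ ≤ r²/2`, `s = 1/4`): it is homotopy equivalent to the interval `(-r², r²)` of values of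
`w = a - b` (the section of `exists_continuousOn_cornerSection` is a homotopy inverse of
`(a, b) ↦ a - b`, sliding along the lines `a - b = w`, whose traces on `V` are intervals).
[cite: Kosinski1993, VI.6, VI.(12.1)] [cite: HatcherAT2002, Ch. 0] -/
theorem contractibleSpace_cornerRegionPos (hε : 0 < ε₀) (hε' : ε₀ ≤ r2 / 2) :
    ContractibleSpace ↥{p : ℝ × ℝ | 0 < p.1 ∧ 0 < p.2 ∧ p.1 < r2 ∧ p.2 < r2 ∧
      0 < cornerFn r2 (1 / 4) p ∧ cornerFn r2 (1 / 4) p < ε₀} := by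
  have hr : 0 < r2 := by linarith
  have h4 : (0 : ℝ) < 1 / 4 := by norm_num
  obtain ⟨sec, hsecc, hsec⟩ := exists_continuousOn_cornerSection hε hε'
  set R : Set (ℝ × ℝ) := {p : ℝ × ℝ | 0 < p.1 ∧ 0 < p.2 ∧ p.1 < r2 ∧ p.2 < r2 ∧
      0 < cornerFn r2 (1 / 4) p ∧ cornerFn r2 (1 / 4) p < ε₀} with hR
  haveI : ContractibleSpace ↥(Ioo (-r2) r2) :=
    Convex.contractibleSpace (convex_Ioo _ _) ⟨0, by simp only [mem_Ioo]; constructor <;> linarith⟩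
  -- `f(a, b) = a - b`
  have hfmem : ∀ p : ↥R, p.1.1 - p.1.2 ∈ Ioo (-r2) r2 := by
    rintro ⟨p, hp1, hp2, hp3, hp4, -, -⟩
    simp only [mem_Ioo]; constructor <;> linarith
  let f : C(↥R, ↥(Ioo (-r2) r2)) :=
    ⟨fun p => ⟨p.1.1 - p.1.2, hfmem p⟩, by fun_prop⟩
  -- the section `g(w) = (w⁺ + sec w, w⁻ + sec w)`
  have hgmem : ∀ w : ↥(Ioo (-r2) r2), (max w.1 0 + sec w.1, max (-w.1) 0 + sec w.1) ∈ R := by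
    rintro ⟨w, hw⟩
    obtain ⟨hsec0, hsec1, hG0, hG1⟩ := hsec w hw
    have e1 := max_zero_add_max_neg_zero_eq_abs_self w
    have hm1 : 0 ≤ max w 0 := le_max_right _ _
    have hm2 : 0 ≤ max (-w) 0 := le_max_right _ _
    simp only [hR, mem_setOf_eq]
    refine ⟨?_, ?_, by linarith, by linarith, hG0, hG1⟩
    · -- `0 < w⁺ + sec w`: if `sec w = 0` then `G ≤ 0`
      rcases hsec0.lt_or_eq with hpos | hzero
      · linarith
      · exfalso
        rw [← hzero] at hG0
        have := cornerFn_lineMap_zero_nonpos (r2 := r2) h4 (w := w) (by linarith)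
        linarith
    · rcases hsec0.lt_or_eq with hpos | hzero
      · linarith
      · exfalso
        rw [← hzero] at hG0
        have := cornerFn_lineMap_zero_nonpos (r2 := r2) h4 (w := w) (by linarith)
        linarith
  have hgcont : Continuous fun w : ↥(Ioo (-r2) r2) =>
      (⟨(max w.1 0 + sec w.1, max (-w.1) 0 + sec w.1), hgmem w⟩ : ↥R) := by
    refine Continuous.subtype_mk ?_ _
    have hsecc' : Continuous fun w : ↥(Ioo (-r2) r2) => sec w.1 :=
      hsecc.comp_continuous continuous_subtype_val fun w => w.2
    exact ((continuous_subtype_val.max continuous_const).add hsecc').prodMk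
      ((continuous_subtype_val.neg.max continuous_const).add hsecc')
  let g : C(↥(Ioo (-r2) r2), ↥R) := ⟨_, hgcont⟩
  -- `f ∘ g = id`
  have hfg : f.comp g = ContinuousMap.id _ := by
    ext w
    simp only [ContinuousMap.comp_apply, ContinuousMap.coe_mk, ContinuousMap.id_apply, f, g]
    have := max_zero_sub_max_neg_zero_eq_self w.1
    linarith
  -- `g ∘ f ≃ id` by sliding along the lines `a - b = w`
  have hHmem : ∀ (t : I) (p : ↥R),
      ((1 - (t : ℝ)) • (g (f p)).1 + (t : ℝ) • p.1) ∈ R := by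
    intro t p
    have ht0 : 0 ≤ (t : ℝ) := t.2.1
    have ht1 : (t : ℝ) ≤ 1 := t.2.2
    set q : ℝ × ℝ := (g (f p)).1 with hq
    have hqR : q ∈ R := (g (f p)).2
    have hpR : p.1 ∈ R := p.2
    have hwq : q.1 - q.2 = p.1.1 - p.1.2 := by
      simp only [hq, g, f, ContinuousMap.coe_mk]
      have := max_zero_sub_max_neg_zero_eq_self (p.1.1 - p.1.2)
      linarith
    set m : ℝ × ℝ := (1 - (t : ℝ)) • q + (t : ℝ) • p.1 with hm
    have hm1 : m.1 = (1 - t) * q.1 + t * p.1.1 := by simp [hm]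
    have hm2 : m.2 = (1 - t) * q.2 + t * p.1.2 := by simp [hm]
    have hwm : q.1 - q.2 = m.1 - m.2 := by rw [hm1, hm2]; nlinarith [hwq]
    have hwm' : p.1.1 - p.1.2 = m.1 - m.2 := by rw [← hwq]; exact hwm
    change m ∈ R
    simp only [hR, mem_setOf_eq] at hqR hpR ⊢
    rcases le_total q.1 p.1.1 with hle | hle
    · exact mem_cornerRegionPos_of_between h4 hqR hpR hwm hwm' (by rw [hm1]; nlinarith)
        (by rw [hm1]; nlinarith)
    · exact mem_cornerRegionPos_of_between h4 hpR hqR hwm' hwm (by rw [hm1]; nlinarith)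
        (by rw [hm1]; nlinarith)
  have hHcont : Continuous fun tp : I × ↥R =>
      (⟨(1 - (tp.1 : ℝ)) • (g (f tp.2)).1 + (tp.1 : ℝ) • tp.2.1, hHmem tp.1 tp.2⟩ : ↥R) := by
    refine Continuous.subtype_mk ?_ _
    have hc1 : Continuous fun tp : I × ↥R => ((g (f tp.2)).1 : ℝ × ℝ) :=
      continuous_subtype_val.comp ((g.continuous.comp f.continuous).comp continuous_snd)
    fun_prop
  let H : (g.comp f).Homotopy (ContinuousMap.id ↥R) :=
    { toFun := fun tp => ⟨(1 - (tp.1 : ℝ)) • (g (f tp.2)).1 + (tp.1 : ℝ) • tp.2.1, hHmem tp.1 tp.2⟩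
      continuous_toFun := hHcont
      map_zero_left := fun p => by
        ext : 1
        simp only [ContinuousMap.comp_apply]
        simp
      map_one_left := fun p => by
        ext : 1
        simp }
  have e : ContinuousMap.HomotopyEquiv ↥R ↥(Ioo (-r2) r2) :=
    { toFun := f
      invFun := g
      left_inv := ⟨H⟩
      right_inv := by rw [hfg] }
  exact e.contractibleSpace

/-- **The region `W = {(a, b) ∈ (0, r²)² | G(a, b) < ε₀}` is contractible** (same proof, same
section). [cite: Kosinski1993, VI.6, VI.(12.1)] [cite: HatcherAT2002, Ch. 0] -/
theorem contractibleSpace_cornerRegion (hε : 0 < ε₀) (hε' : ε₀ ≤ r2 / 2) :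
    ContractibleSpace ↥{p : ℝ × ℝ | 0 < p.1 ∧ 0 < p.2 ∧ p.1 < r2 ∧ p.2 < r2 ∧
      cornerFn r2 (1 / 4) p < ε₀} := by
  have hr : 0 < r2 := by linarith
  have h4 : (0 : ℝ) < 1 / 4 := by norm_num
  obtain ⟨sec, hsecc, hsec⟩ := exists_continuousOn_cornerSection hε hε'
  set R : Set (ℝ × ℝ) := {p : ℝ × ℝ | 0 < p.1 ∧ 0 < p.2 ∧ p.1 < r2 ∧ p.2 < r2 ∧
      cornerFn r2 (1 / 4) p < ε₀} with hR
  haveI : ContractibleSpace ↥(Ioo (-r2) r2) :=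
    Convex.contractibleSpace (convex_Ioo _ _) ⟨0, by simp only [mem_Ioo]; constructor <;> linarith⟩
  have hfmem : ∀ p : ↥R, p.1.1 - p.1.2 ∈ Ioo (-r2) r2 := by
    rintro ⟨p, hp1, hp2, hp3, hp4, -⟩
    simp only [mem_Ioo]; constructor <;> linarith
  let f : C(↥R, ↥(Ioo (-r2) r2)) :=
    ⟨fun p => ⟨p.1.1 - p.1.2, hfmem p⟩, by fun_prop⟩
  have hgmem : ∀ w : ↥(Ioo (-r2) r2), (max w.1 0 + sec w.1, max (-w.1) 0 + sec w.1) ∈ R := by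
    rintro ⟨w, hw⟩
    obtain ⟨hsec0, hsec1, hG0, hG1⟩ := hsec w hw
    have e1 := max_zero_add_max_neg_zero_eq_abs_self w
    have hm1 : 0 ≤ max w 0 := le_max_right _ _
    have hm2 : 0 ≤ max (-w) 0 := le_max_right _ _
    simp only [hR, mem_setOf_eq]
    refine ⟨?_, ?_, by linarith, by linarith, hG1⟩
    · rcases hsec0.lt_or_eq with hpos | hzero
      · linarith
      · exfalso
        rw [← hzero] at hG0
        have := cornerFn_lineMap_zero_nonpos (r2 := r2) h4 (w := w) (by linarith)
        linarith
    · rcases hsec0.lt_or_eq with hpos | hzero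
      · linarith
      · exfalso
        rw [← hzero] at hG0
        have := cornerFn_lineMap_zero_nonpos (r2 := r2) h4 (w := w) (by linarith)
        linarith
  have hgcont : Continuous fun w : ↥(Ioo (-r2) r2) =>
      (⟨(max w.1 0 + sec w.1, max (-w.1) 0 + sec w.1), hgmem w⟩ : ↥R) := by
    refine Continuous.subtype_mk ?_ _
    have hsecc' : Continuous fun w : ↥(Ioo (-r2) r2) => sec w.1 :=
      hsecc.comp_continuous continuous_subtype_val fun w => w.2
    exact ((continuous_subtype_val.max continuous_const).add hsecc').prodMk
      ((continuous_subtype_val.neg.max continuous_const).add hsecc')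
  let g : C(↥(Ioo (-r2) r2), ↥R) := ⟨_, hgcont⟩
  have hfg : f.comp g = ContinuousMap.id _ := by
    ext w
    simp only [ContinuousMap.comp_apply, ContinuousMap.coe_mk, ContinuousMap.id_apply, f, g]
    have := max_zero_sub_max_neg_zero_eq_self w.1
    linarith
  have hHmem : ∀ (t : I) (p : ↥R),
      ((1 - (t : ℝ)) • (g (f p)).1 + (t : ℝ) • p.1) ∈ R := by
    intro t p
    have ht0 : 0 ≤ (t : ℝ) := t.2.1
    have ht1 : (t : ℝ) ≤ 1 := t.2.2
    set q : ℝ × ℝ := (g (f p)).1 with hq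
    have hqR : q ∈ R := (g (f p)).2
    have hpR : p.1 ∈ R := p.2
    have hwq : q.1 - q.2 = p.1.1 - p.1.2 := by
      simp only [hq, g, f, ContinuousMap.coe_mk]
      have := max_zero_sub_max_neg_zero_eq_self (p.1.1 - p.1.2)
      linarith
    set m : ℝ × ℝ := (1 - (t : ℝ)) • q + (t : ℝ) • p.1 with hm
    have hm1 : m.1 = (1 - t) * q.1 + t * p.1.1 := by simp [hm]
    have hm2 : m.2 = (1 - t) * q.2 + t * p.1.2 := by simp [hm]
    have hwm : q.1 - q.2 = m.1 - m.2 := by rw [hm1, hm2]; nlinarith [hwq]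
    have hwm' : p.1.1 - p.1.2 = m.1 - m.2 := by rw [← hwq]; exact hwm
    change m ∈ R
    simp only [hR, mem_setOf_eq] at hqR hpR ⊢
    rcases le_total q.1 p.1.1 with hle | hle
    · exact mem_cornerRegion_of_between h4 hqR hpR hwm hwm' (by rw [hm1]; nlinarith)
        (by rw [hm1]; nlinarith)
    · exact mem_cornerRegion_of_between h4 hpR hqR hwm' hwm (by rw [hm1]; nlinarith)
        (by rw [hm1]; nlinarith)
  have hHcont : Continuous fun tp : I × ↥R =>
      (⟨(1 - (tp.1 : ℝ)) • (g (f tp.2)).1 + (tp.1 : ℝ) • tp.2.1, hHmem tp.1 tp.2⟩ : ↥R) := by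
    refine Continuous.subtype_mk ?_ _
    have hc1 : Continuous fun tp : I × ↥R => ((g (f tp.2)).1 : ℝ × ℝ) :=
      continuous_subtype_val.comp ((g.continuous.comp f.continuous).comp continuous_snd)
    fun_prop
  let H : (g.comp f).Homotopy (ContinuousMap.id ↥R) :=
    { toFun := fun tp => ⟨(1 - (tp.1 : ℝ)) • (g (f tp.2)).1 + (tp.1 : ℝ) • tp.2.1, hHmem tp.1 tp.2⟩
      continuous_toFun := hHcont
      map_zero_left := fun p => by
        ext : 1
        simp only [ContinuousMap.comp_apply]
        simp
      map_one_left := fun p => by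
        ext : 1
        simp }
  have e : ContinuousMap.HomotopyEquiv ↥R ↥(Ioo (-r2) r2) :=
    { toFun := f
      invFun := g
      left_inv := ⟨H⟩
      right_inv := by rw [hfg] }
  exact e.contractibleSpace

/-- **`V` is simply connected.** [cite: Kosinski1993, VI.(12.1)] -/
theorem isSimplyConnected_cornerRegionPos (hε : 0 < ε₀) (hε' : ε₀ ≤ r2 / 2) :
    IsSimplyConnected {p : ℝ × ℝ | 0 < p.1 ∧ 0 < p.2 ∧ p.1 < r2 ∧ p.2 < r2 ∧
      0 < cornerFn r2 (1 / 4) p ∧ cornerFn r2 (1 / 4) p < ε₀} := by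
  haveI := contractibleSpace_cornerRegionPos hε hε'
  change SimplyConnectedSpace _
  infer_instance

/-- **`W` is simply connected.** [cite: Kosinski1993, VI.(12.1)] -/
theorem isSimplyConnected_cornerRegion (hε : 0 < ε₀) (hε' : ε₀ ≤ r2 / 2) :
    IsSimplyConnected {p : ℝ × ℝ | 0 < p.1 ∧ 0 < p.2 ∧ p.1 < r2 ∧ p.2 < r2 ∧
      cornerFn r2 (1 / 4) p < ε₀} := by
  haveI := contractibleSpace_cornerRegion hε hε'
  change SimplyConnectedSpace _
  infer_instance

/-- `V` is path connected. [folklore] -/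
theorem isPathConnected_cornerRegionPos (hε : 0 < ε₀) (hε' : ε₀ ≤ r2 / 2) :
    IsPathConnected {p : ℝ × ℝ | 0 < p.1 ∧ 0 < p.2 ∧ p.1 < r2 ∧ p.2 < r2 ∧
      0 < cornerFn r2 (1 / 4) p ∧ cornerFn r2 (1 / 4) p < ε₀} :=
  (isSimplyConnected_cornerRegionPos hε hε').isPathConnected

/-- `W` is path connected. [folklore] -/
theorem isPathConnected_cornerRegion (hε : 0 < ε₀) (hε' : ε₀ ≤ r2 / 2) :
    IsPathConnected {p : ℝ × ℝ | 0 < p.1 ∧ 0 < p.2 ∧ p.1 < r2 ∧ p.2 < r2 ∧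
      cornerFn r2 (1 / 4) p < ε₀} :=
  (isSimplyConnected_cornerRegion hε hε').isPathConnected

end Plumbing

end Literature.Topology.FourManifolds
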